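import Summits.AtomisticToContinuum.FouriersLaw.Theorems.CageBudgetFeketeHeatVarianceCalculusLaplace
import HarnessLib

/-!
# Stub `stub_filterTransfer` of line `Sketch`
(crux `CoercivePulse.AbelRegularity`, item stmt-AtomisticToContinuum-15384; `--supports` file, closes nothing)

WHAT. The registered stub S2 of the skeleton `Cruxes/AbelRegularity/Lines/Sketch.lean`: for a continuous `F`
with `|F| ≤ M`, a continuous `ψ ≥ 0` and `U ≥ 0`, the causally filtered memory
`F^ψ(t) = ∫_{[0,U]} ψ(u) F(t+u) du` is continuous, `|F^ψ| ≤ M ∫_{[0,U]} ψ`, its Abel means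
`A[F^ψ](ν) = ∫₀^∞ e^{-νt} F^ψ(t) dt` are bounded below on `(0,1]` as soon as `A[F] ≥ 0`, and, if `∫_{[0,U]} ψ > 0`,
the Abel dichotomy (finite limit or `+∞` along `𝓝[>] 0`) transfers from `F^ψ` back to `F`.

HOW. Fubini on `(0,∞) × [0,U]` and the translation `t ↦ t + u` of Lebesgue measure give the key identity
`A[F^ψ](ν) = ∫_{[0,U]} ψ(u) e^{νu} (A[F](ν) − ∫₀ᵘ e^{-νs} F(s) ds) du = m(ν) A[F](ν) − R(ν)` for `ν > 0`, with
`m(ν) = ∫ ψ(u) e^{νu} du → ∫ψ > 0` and `R(ν) → R(0)` as `ν → 0` (parametric interval integrals of jointly continuous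
integrands), `|∫₀ᵘ e^{-νs}F| ≤ M u`. Then `A[F] = (A[F^ψ] + R)/m` eventually along `𝓝[>] 0`.
-/

noncomputable section

namespace Summit.AtomisticToContinuum.FouriersLaw.Theorems.AbelRegularity.Sketch

open MeasureTheory Filter Set Function
open scoped Topology
open Summit.AtomisticToContinuum.FouriersLaw.Theorems.HeatVarianceCalculus.CanonicalRigidity
  (integrableOn_exp_neg_mul_of_abs_le_pow)

/-! ### Bookkeeping -/

/-- On `ℝ`, `∫_{[0,U]} f = ∫₀^U f` for `0 ≤ U`. [folklore] -/
theorem integral_Icc_eq_intervalIntegral {U : ℝ} (hU : 0 ≤ U) (f : ℝ → ℝ) :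
    ∫ u in Icc 0 U, f u = ∫ u in (0:ℝ)..U, f u := by
  rw [integral_Icc_eq_integral_Ioc, intervalIntegral.integral_of_le hU]

/-- Translation on the half-line: `∫_{(0,∞)} f(t + c) dt = ∫_{(c,∞)} f`. [folklore] -/
theorem setIntegral_Ioi_zero_comp_add_right (f : ℝ → ℝ) (c : ℝ) :
    ∫ t in Ioi (0:ℝ), f (t + c) = ∫ t in Ioi c, f t := by
  have := (measurePreserving_add_right volume c).setIntegral_preimage_emb
    (measurableEmbedding_addRight c) f (Ioi c)
  simpa [preimage_add_const_Ioi] using this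

/-- Laplace integrability of a bounded continuous function on `(0, ∞)`. [folklore] -/
theorem integrableOn_exp_neg_mul_of_abs_le {F : ℝ → ℝ} (hF : Continuous F) {M : ℝ}
    (hM : ∀ t : ℝ, |F t| ≤ M) {ν : ℝ} (hν : 0 < ν) :
    IntegrableOn (fun t : ℝ => Real.exp (-(ν * t)) * F t) (Ioi 0) :=
  integrableOn_exp_neg_mul_of_abs_le_pow hF (K := M) (n := 0) (fun t _ => by simpa using hM t) hν

/-- The Laplace primitive `u ↦ ∫₀ᵘ e^{-νs} F(s) ds` is continuous. [folklore] -/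
theorem continuous_primitive_exp_neg_mul {F : ℝ → ℝ} (hF : Continuous F) (ν : ℝ) :
    Continuous fun u : ℝ => ∫ s in (0:ℝ)..u, Real.exp (-(ν * s)) * F s := by
  have hc : Continuous fun s : ℝ => Real.exp (-(ν * s)) * F s := by fun_prop
  exact continuous_iff_continuousAt.2 fun u =>
    (hc.integral_hasStrictDerivAt 0 u).hasDerivAt.continuousAt

/-- `|∫₀ᵘ e^{-νs} F(s) ds| ≤ M u` for `u ≥ 0`, `ν ≥ 0`, `|F| ≤ M`. [folklore] -/
theorem abs_primitive_le {F : ℝ → ℝ} {M : ℝ} (hM : ∀ t : ℝ, |F t| ≤ M) {ν u : ℝ} (hν : 0 ≤ ν)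
    (hu : 0 ≤ u) : |∫ s in (0:ℝ)..u, Real.exp (-(ν * s)) * F s| ≤ M * u := by
  have h := intervalIntegral.norm_integral_le_of_norm_le_const (a := (0:ℝ)) (b := u) (C := M)
    (f := fun s => Real.exp (-(ν * s)) * F s) fun s hs => by
      rw [uIoc_of_le hu] at hs
      rw [Real.norm_eq_abs, abs_mul, abs_of_pos (Real.exp_pos _)]
      calc Real.exp (-(ν * s)) * |F s| ≤ 1 * |F s| :=
            mul_le_mul_of_nonneg_right
              (Real.exp_le_one_iff.2 (neg_nonpos.2 (mul_nonneg hν hs.1.le))) (abs_nonneg _)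
        _ ≤ M := by rw [one_mul]; exact hM s
  rw [Real.norm_eq_abs, sub_zero, abs_of_nonneg hu] at h
  exact h

/-! ### (i) continuity and (ii) the uniform bound of the filtered memory -/

/-- (i) The causally filtered memory `t ↦ ∫_{[0,U]} ψ(u) F(t+u) du` is continuous. [folklore] -/
theorem continuous_filter {F ψ : ℝ → ℝ} (hF : Continuous F) (hψ : Continuous ψ) {U : ℝ}
    (hU : 0 ≤ U) : Continuous fun t : ℝ => ∫ u in Icc (0:ℝ) U, ψ u * F (t + u) := by
  simp_rw [integral_Icc_eq_intervalIntegral hU]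
  exact intervalIntegral.continuous_parametric_intervalIntegral_of_continuous'
    (f := fun t u => ψ u * F (t + u))
    (show Continuous fun p : ℝ × ℝ => ψ p.2 * F (p.1 + p.2) by fun_prop) 0 U

/-- (ii) `|∫_{[0,U]} ψ(u)F(t+u)du| ≤ M ∫_{[0,U]} ψ`. [folklore] -/
theorem abs_filter_le {F ψ : ℝ → ℝ} {M : ℝ} (hM : ∀ t : ℝ, |F t| ≤ M) (hψ : Continuous ψ)
    (hψ0 : ∀ u : ℝ, 0 ≤ ψ u) (U t : ℝ) :
    |∫ u in Icc (0:ℝ) U, ψ u * F (t + u)| ≤ M * ∫ u in Icc (0:ℝ) U, ψ u := by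
  rw [← MeasureTheory.integral_const_mul, ← Real.norm_eq_abs]
  have hi : IntegrableOn (fun u : ℝ => M * ψ u) (Icc (0:ℝ) U) :=
    Continuous.integrableOn_Icc (by fun_prop)
  refine norm_integral_le_of_norm_le hi (Eventually.of_forall fun u => ?_)
  rw [Real.norm_eq_abs, abs_mul, abs_of_nonneg (hψ0 u), mul_comm M]
  exact mul_le_mul_of_nonneg_left (hM _) (hψ0 u)

/-! ### The key identity `A[F^ψ] = m A[F] − R` -/

/-- `∫_{(0,∞)} e^{-νt} F(t+u) dt = e^{νu} (A[F](ν) − ∫₀ᵘ e^{-νs}F(s) ds)` for `u ≥ 0`, `ν > 0`. [folklore] -/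
theorem laplace_translate {F : ℝ → ℝ} (hF : Continuous F) {M : ℝ} (hM : ∀ t : ℝ, |F t| ≤ M)
    {ν : ℝ} (hν : 0 < ν) {u : ℝ} (hu : 0 ≤ u) :
    ∫ t in Ioi (0:ℝ), Real.exp (-(ν * t)) * F (t + u) =
      Real.exp (ν * u) * ((∫ t in Set.Ioi (0:ℝ), Real.exp (-(ν * t)) * F t) -
        ∫ s in (0:ℝ)..u, Real.exp (-(ν * s)) * F s) := by
  have e1 : EqOn (fun t : ℝ => Real.exp (-(ν * t)) * F (t + u))
      (fun t : ℝ => Real.exp (ν * u) * (Real.exp (-(ν * (t + u))) * F (t + u))) (Ioi 0) :=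
    fun t _ => by
      simp only
      rw [← mul_assoc, ← Real.exp_add]
      congr 2
      ring
  rw [setIntegral_congr_fun measurableSet_Ioi e1, MeasureTheory.integral_const_mul]
  congr 1
  rw [setIntegral_Ioi_zero_comp_add_right (fun s => Real.exp (-(ν * s)) * F s) u]
  have hint := integrableOn_exp_neg_mul_of_abs_le hF hM hν
  rw [eq_sub_iff_add_eq',
    intervalIntegral.integral_interval_add_Ioi hint (hint.mono_set (Ioi_subset_Ioi hu))]

/-- Integrability of `(t,u) ↦ e^{-νt} ψ(u) F(t+u)` on `(0,∞) × [0,U]`. [folklore] -/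
theorem integrable_prod_filter {F ψ : ℝ → ℝ} (hF : Continuous F) {M : ℝ}
    (hM : ∀ t : ℝ, |F t| ≤ M) (hψ : Continuous ψ) (hψ0 : ∀ u : ℝ, 0 ≤ ψ u) {ν : ℝ} (hν : 0 < ν)
    (U : ℝ) :
    Integrable (uncurry fun t u : ℝ => Real.exp (-(ν * t)) * (ψ u * F (t + u)))
      ((volume.restrict (Ioi (0:ℝ))).prod (volume.restrict (Icc (0:ℝ) U))) := by
  have h1 : IntegrableOn (fun t : ℝ => Real.exp (-(ν * t))) (Ioi (0:ℝ)) := by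
    have h := exp_neg_integrableOn_Ioi 0 hν
    simp only [neg_mul] at h
    exact h
  have h2 : IntegrableOn (fun u : ℝ => M * ψ u) (Icc (0:ℝ) U) :=
    Continuous.integrableOn_Icc (by fun_prop)
  refine Integrable.mono' (Integrable.mul_prod h1 h2) ?_ (Eventually.of_forall fun z => ?_)
  · exact (show Continuous fun z : ℝ × ℝ => Real.exp (-(ν * z.1)) * (ψ z.2 * F (z.1 + z.2)) by
      fun_prop).aestronglyMeasurable
  · rcases z with ⟨t, u⟩
    simp only [uncurry_apply_pair]
    rw [Real.norm_eq_abs, abs_mul, abs_of_pos (Real.exp_pos _), abs_mul, abs_of_nonneg (hψ0 u)]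
    refine mul_le_mul_of_nonneg_left ?_ (Real.exp_pos _).le
    rw [mul_comm M]
    exact mul_le_mul_of_nonneg_left (hM _) (hψ0 u)

/-- **Key identity, first form.** For `ν > 0`:
`A[F^ψ](ν) = ∫_{[0,U]} ψ(u) e^{νu} (A[F](ν) − ∫₀ᵘ e^{-νs}F(s)ds) du`. [folklore] -/
theorem laplace_filter_eq {F ψ : ℝ → ℝ} (hF : Continuous F) {M : ℝ} (hM : ∀ t : ℝ, |F t| ≤ M)
    (hψ : Continuous ψ) (hψ0 : ∀ u : ℝ, 0 ≤ ψ u) (U : ℝ) {ν : ℝ} (hν : 0 < ν) :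
    ∫ t in Set.Ioi (0:ℝ), Real.exp (-(ν * t)) * ∫ u in Set.Icc (0:ℝ) U, ψ u * F (t + u) =
      ∫ u in Set.Icc (0:ℝ) U, ψ u * Real.exp (ν * u) *
        ((∫ t in Set.Ioi (0:ℝ), Real.exp (-(ν * t)) * F t) -
          ∫ s in (0:ℝ)..u, Real.exp (-(ν * s)) * F s) := by
  have step1 : ∀ t : ℝ, Real.exp (-(ν * t)) * ∫ u in Icc (0:ℝ) U, ψ u * F (t + u) =
      ∫ u in Icc (0:ℝ) U, Real.exp (-(ν * t)) * (ψ u * F (t + u)) := fun t =>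
    (MeasureTheory.integral_const_mul _ _).symm
  simp_rw [step1]
  rw [show (∫ t in Ioi (0:ℝ), ∫ u in Icc (0:ℝ) U, Real.exp (-(ν * t)) * (ψ u * F (t + u))) =
      ∫ u in Icc (0:ℝ) U, ∫ t in Ioi (0:ℝ), Real.exp (-(ν * t)) * (ψ u * F (t + u)) from
    integral_integral_swap (integrable_prod_filter hF hM hψ hψ0 hν U)]
  refine setIntegral_congr_fun measurableSet_Icc fun u hu => ?_
  have e2 : ∀ t : ℝ, Real.exp (-(ν * t)) * (ψ u * F (t + u)) =
      ψ u * (Real.exp (-(ν * t)) * F (t + u)) := fun t => by ring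
  simp_rw [e2]
  rw [MeasureTheory.integral_const_mul, laplace_translate hF hM hν hu.1, ← mul_assoc]

/-- **Key identity, second form.** For `ν > 0`: `A[F^ψ](ν) = m(ν) A[F](ν) − R(ν)` with
`m(ν) = ∫_{[0,U]} ψ(u)e^{νu}du` and `R(ν) = ∫_{[0,U]} ψ(u)e^{νu}∫₀ᵘe^{-νs}F(s)ds du`. [folklore] -/
theorem laplace_filter_eq' {F ψ : ℝ → ℝ} (hF : Continuous F) {M : ℝ} (hM : ∀ t : ℝ, |F t| ≤ M)
    (hψ : Continuous ψ) (hψ0 : ∀ u : ℝ, 0 ≤ ψ u) (U : ℝ) {ν : ℝ} (hν : 0 < ν) :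
    ∫ t in Set.Ioi (0:ℝ), Real.exp (-(ν * t)) * ∫ u in Set.Icc (0:ℝ) U, ψ u * F (t + u) =
      (∫ u in Set.Icc (0:ℝ) U, ψ u * Real.exp (ν * u)) *
          (∫ t in Set.Ioi (0:ℝ), Real.exp (-(ν * t)) * F t) -
        ∫ u in Set.Icc (0:ℝ) U, ψ u * Real.exp (ν * u) *
          ∫ s in (0:ℝ)..u, Real.exp (-(ν * s)) * F s := by
  rw [laplace_filter_eq hF hM hψ hψ0 U hν]
  simp_rw [mul_sub]
  rw [MeasureTheory.integral_sub, MeasureTheory.integral_mul_const]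
  · exact Continuous.integrableOn_Icc (by fun_prop)
  · exact ((hψ.fun_mul (by fun_prop : Continuous fun u : ℝ => Real.exp (ν * u))).fun_mul
      (continuous_primitive_exp_neg_mul hF ν)).integrableOn_Icc

/-! ### Continuity of the weight `m` and of the remainder `R` in `ν` -/

/-- `ν ↦ m(ν) = ∫_{[0,U]} ψ(u) e^{νu} du` is continuous. [folklore] -/
theorem continuous_weight {ψ : ℝ → ℝ} (hψ : Continuous ψ) {U : ℝ} (hU : 0 ≤ U) :
    Continuous fun ν : ℝ => ∫ u in Set.Icc (0:ℝ) U, ψ u * Real.exp (ν * u) := by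
  simp_rw [integral_Icc_eq_intervalIntegral hU]
  exact intervalIntegral.continuous_parametric_intervalIntegral_of_continuous'
    (f := fun ν u => ψ u * Real.exp (ν * u))
    (show Continuous fun p : ℝ × ℝ => ψ p.2 * Real.exp (p.1 * p.2) by fun_prop) 0 U

/-- `ν ↦ R(ν) = ∫_{[0,U]} ψ(u) e^{νu} ∫₀ᵘ e^{-νs}F(s) ds du` is continuous. [folklore] -/
theorem continuous_remainder {F ψ : ℝ → ℝ} (hF : Continuous F) (hψ : Continuous ψ) {U : ℝ}
    (hU : 0 ≤ U) :
    Continuous fun ν : ℝ => ∫ u in Set.Icc (0:ℝ) U,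
      ψ u * Real.exp (ν * u) * ∫ s in (0:ℝ)..u, Real.exp (-(ν * s)) * F s := by
  simp_rw [integral_Icc_eq_intervalIntegral hU]
  have hP : Continuous fun p : ℝ × ℝ => ∫ s in (0:ℝ)..p.2, Real.exp (-(p.1 * s)) * F s :=
    intervalIntegral.continuous_parametric_primitive_of_continuous
      (f := fun ν s => Real.exp (-(ν * s)) * F s)
      (show Continuous fun p : ℝ × ℝ => Real.exp (-(p.1 * p.2)) * F p.2 by fun_prop)
  exact intervalIntegral.continuous_parametric_intervalIntegral_of_continuous'
    (f := fun ν u => ψ u * Real.exp (ν * u) * ∫ s in (0:ℝ)..u, Real.exp (-(ν * s)) * F s)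
    (show Continuous fun p : ℝ × ℝ => ψ p.2 * Real.exp (p.1 * p.2) *
        ∫ s in (0:ℝ)..p.2, Real.exp (-(p.1 * s)) * F s from
      ((hψ.comp continuous_snd).fun_mul (by fun_prop)).fun_mul hP) 0 U

/-- Pointwise lower bound used in (iii): with `0 ≤ ψu`, `0 ≤ e ≤ eU`, `|P| ≤ MU`, `0 ≤ MU`, `0 ≤ A`:
`-(eU·MU)·ψu ≤ ψu·e·(A − P)`. [folklore] -/
theorem pointwise_lower_bound {ψu e eU MU A P : ℝ} (hψu : 0 ≤ ψu) (he : 0 ≤ e) (heU : e ≤ eU)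
    (hMU : 0 ≤ MU) (hP : |P| ≤ MU) (hA : 0 ≤ A) : -(eU * MU) * ψu ≤ ψu * e * (A - P) := by
  have h1 : -MU ≤ A - P := by linarith [(abs_le.1 hP).2]
  calc -(eU * MU) * ψu = ψu * eU * (-MU) := by ring
    _ ≤ ψu * e * (-MU) :=
        mul_le_mul_of_nonpos_right (mul_le_mul_of_nonneg_left heU hψu) (neg_nonpos.2 hMU)
    _ ≤ ψu * e * (A - P) := mul_le_mul_of_nonneg_left h1 (mul_nonneg hψu he)

/-! ### The registered stub -/

/-- **Stub S2 — `filterTransfer` (causal filtering of a bounded continuous memory; Fubini).** For continuous `F`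
with `|F| ≤ M`, continuous `ψ ≥ 0` and `U ≥ 0`, with `F^ψ(t) = ∫_{[0,U]} ψ(u)F(t+u)du`: (i) `F^ψ` is continuous;
(ii) `|F^ψ(t)| ≤ M∫_{[0,U]}ψ`; (iii) if `A[F](ν) ≥ 0` for all `ν > 0` then `A[F^ψ]` is bounded below on `(0,1]`;
(iv) if `∫_{[0,U]}ψ > 0` then `Dichotomy(F^ψ) ⇒ Dichotomy(F)`. Proof: Fubini on `[0,U] × (0,∞)` gives
`A[F^ψ](ν) = ∫ψ(u)e^{νu}(A[F](ν) − ∫₀ᵘe^{-νs}F(s)ds)du`, i.e. `A[F^ψ] = m(ν)A[F] − R(ν)` with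
`m(ν) = ∫ψ(u)e^{νu}du → ∫ψ > 0`, `|R(ν)| ≤ e^{νU}MU∫ψ`, `R(ν) → R(0)` as `ν ↓ 0`. [folklore] -/
theorem stub_filterTransfer :
    ∀ (F : ℝ → ℝ) (M : ℝ) (ψ : ℝ → ℝ) (U : ℝ), Continuous F → (∀ t : ℝ, |F t| ≤ M) → Continuous ψ → 0 ≤ U → (∀ u : ℝ, 0 ≤ ψ u) → Continuous (fun t : ℝ => ∫ u in Set.Icc (0:ℝ) U, ψ u * F (t + u)) ∧ (∀ t : ℝ, |∫ u in Set.Icc (0:ℝ) U, ψ u * F (t + u)| ≤ M * ∫ u in Set.Icc (0:ℝ) U, ψ u) ∧ ((∀ ν : ℝ, 0 < ν → 0 ≤ ∫ t in Set.Ioi (0:ℝ), Real.exp (-(ν * t)) * F t) → ∃ b : ℝ, ∀ ν : ℝ, 0 < ν → ν ≤ 1 → b ≤ ∫ t in Set.Ioi (0:ℝ), Real.exp (-(ν * t)) * ∫ u in Set.Icc (0:ℝ) U, ψ u * F (t + u)) ∧ (0 < ∫ u in Set.Icc (0:ℝ) U, ψ u → ((∃ L : ℝ, Filter.Tendsto (fun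 ν : ℝ => ∫ t in Set.Ioi (0:ℝ), Real.exp (-(ν * t)) * ∫ u in Set.Icc (0:ℝ) U, ψ u * F (t + u)) (nhdsWithin (0:ℝ) (Set.Ioi 0)) (nhds L)) ∨ Filter.Tendsto (fun ν : ℝ => ∫ t in Set.Ioi (0:ℝ), Real.exp (-(ν * t)) * ∫ u in Set.Icc (0:ℝ) U, ψ u * F (t + u)) (nhdsWithin (0:ℝ) (Set.Ioi 0)) Filter.atTop) → ((∃ L : ℝ, Filter.Tendsto (fun ν : ℝ => ∫ t in Set.Ioi (0:ℝ), Real.exp (-(ν * t)) * F t) (nhdsWithin (0:ℝ) (Set.Ioi 0)) (nhds L)) ∨ Filter.Tendsto (fun ν : ℝ => ∫ t in Set.Ioi (0:ℝ), Real.exp (-(ν * t)) * F t) (nhdsWithin (0:ℝ) (Set.Ioi 0)) Filter.atTop)) := by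
  intro F M ψ U hF hM hψ hU hψ0
  have hM0 : 0 ≤ M := (abs_nonneg _).trans (hM 0)
  refine ⟨continuous_filter hF hψ hU, abs_filter_le hM hψ hψ0 U, fun hA => ?_, fun hpos hdich => ?_⟩
  · -- (iii) lower bound of `A[F^ψ]` on `(0,1]`
    refine ⟨-(Real.exp U * (M * U)) * ∫ u in Set.Icc (0:ℝ) U, ψ u, fun ν hν hν1 => ?_⟩
    rw [laplace_filter_eq hF hM hψ hψ0 U hν, ← MeasureTheory.integral_const_mul]
    refine setIntegral_mono_on (Continuous.integrableOn_Icc (by fun_prop)) ?_ measurableSet_Icc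
      fun u hu => ?_
    · exact ((hψ.fun_mul (by fun_prop : Continuous fun u : ℝ => Real.exp (ν * u))).fun_mul
        (continuous_const.fun_sub (continuous_primitive_exp_neg_mul hF ν))).integrableOn_Icc
    · exact pointwise_lower_bound (hψ0 u) (Real.exp_pos _).le
        (Real.exp_le_exp.2 ((mul_le_of_le_one_left hu.1 hν1).trans hu.2)) (mul_nonneg hM0 hU)
        ((abs_primitive_le hM hν.le hu.1).trans (mul_le_mul_of_nonneg_left hu.2 hM0)) (hA ν hν)
  · -- (iv) transfer of the dichotomy
    have hm : Tendsto (fun ν : ℝ => ∫ u in Set.Icc (0:ℝ) U, ψ u * Real.exp (ν * u))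
        (𝓝[>] 0) (𝓝 (∫ u in Set.Icc (0:ℝ) U, ψ u)) := by
      have h := (continuous_weight hψ hU).tendsto 0
      simp only [zero_mul, Real.exp_zero, mul_one] at h
      exact h.mono_left nhdsWithin_le_nhds
    have hR := ((continuous_remainder hF hψ hU).tendsto 0).mono_left (nhdsWithin_le_nhds (s := Ioi 0))
    have hev : ∀ᶠ ν in 𝓝[>] (0:ℝ),
        ((∫ t in Set.Ioi (0:ℝ), Real.exp (-(ν * t)) * ∫ u in Set.Icc (0:ℝ) U, ψ u * F (t + u)) +
            ∫ u in Set.Icc (0:ℝ) U, ψ u * Real.exp (ν * u) *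
              ∫ s in (0:ℝ)..u, Real.exp (-(ν * s)) * F s) *
          (∫ u in Set.Icc (0:ℝ) U, ψ u * Real.exp (ν * u))⁻¹ =
        ∫ t in Set.Ioi (0:ℝ), Real.exp (-(ν * t)) * F t := by
      filter_upwards [self_mem_nhdsWithin, hm.eventually (lt_mem_nhds hpos)] with ν hν hmν
      rw [laplace_filter_eq' hF hM hψ hψ0 U hν, sub_add_cancel, mul_comm, ← mul_assoc,
        inv_mul_cancel₀ hmν.ne', one_mul]
    rcases hdich with ⟨L, hL⟩ | htop
    · exact Or.inl ⟨_, ((hL.add hR).mul (hm.inv₀ hpos.ne')).congr' hev⟩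
    · exact Or.inr (((htop.atTop_add hR).atTop_mul_pos (inv_pos.2 hpos) (hm.inv₀ hpos.ne')).congr' hev)

end Summit.AtomisticToContinuum.FouriersLaw.Theorems.AbelRegularity.Sketch

end
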